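import Mathlib

/-!
# TerminalLayerBridge — ONE trace vocabulary for the two g3 packages on `ScarEnvelopeTypeI`
(stmt-NavierStokesRegularity-23843): the pointwise FINAL SLICE (`TerminalLayer.HasFinalSlice`,
ns-idea-17 g3) versus the distributional FINAL TRACE (`FinalTrace.HasZeroTraceOn` /
`FinalTrace.TraceEssBddOn`, ns-idea-18 g3)

Price V10-P2 = V11-P3 of ns-wall-crit-1 g0 (2026-08-28): «must be bridged by ONE lemma each way on
the regular set (`traceEssBddOn_of_hasFinalSlice_bdd`, and slice = trace a.e. where both exist) so
the two g3 packages compose».  Paid here by ns-idea-17 g4, Mathlib-only and kernel-checked.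

The two sketches live under `Cruxes/ScarEnvelopeTypeI/` and are NOT modules of the farm build graph
(`lean check` on an importing file answers `remote:stale:unbuilt:…FinalTraceSketch`), so the five
definitions below are VERBATIM COPIES of
`…Cruxes.ScarEnvelopeTypeI.ZoomDictionary.TerminalLayer.HasFinalSlice` and
`…Cruxes.ScarEnvelopeTypeI.FinalTrace.{finalTime, slicePairing, IsTestOn, HasZeroTraceOn, TraceEssBddOn}`;
when LEAD 23843 lands both packages in `Theorems/`, every lemma of this file transfers by `Iff.rfl`.

Content (all 0 sorry):
* `finalTime_neBot` — the essential final-time filter `(𝓝[<] 0) ⊓ ae volume` is proper, so limits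
  along it are unique (this is what makes «the» distributional final trace well defined);
* `tendsto_slicePairing_of_hasFinalSlice` — a pointwise final slice `u₀` off the origin plus a local
  sup bound on the test field's support (the regular set / the Type-I envelope off the scar) makes
  every slice pairing converge to `∫ ⟪u₀, φ⟫` along `𝓝[<] 0`, hence along `finalTime`
  (`tendsto_slicePairing_finalTime_of_hasFinalSlice`) — dominated convergence;
* `norm_finalSlice_le` — the final slice inherits the local bound;
* `traceEssBddOn_of_hasFinalSlice_bdd` — THE NAMED BRIDGE (slice side ⇒ trace side on the regular set);
* `tracePairing_eq_of_hasFinalSlice` — «slice = trace where both exist» at pairing level: any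
  distributional final trace value `c` of the pairing with `φ` equals `∫ ⟪u₀, φ⟫`;
* `hasZeroTraceOn_iff_finalSlice_orthogonal` — zero trace on `S` ⟺ the final slice is orthogonal to
  every test field on `S`;
* `finalSlice_ae_eq_trace` — «slice = trace a.e. where both exist»: on an OPEN `S ∌ 0`, any locally
  integrable distributional final trace `v` equals `u₀` a.e. on `S` (Mathlib's fundamental lemma
  `IsOpen.ae_eq_zero_of_integral_contDiff_smul_eq_zero`, applied vector by vector), with the corollary
  `finalSlice_ae_eq_zero_of_hasZeroTraceOn`.

Hygiene: `slicePairing` is a Bochner integral, so measurability of the slices `U s` is an explicit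
hypothesis (in the A–B class it holds); the sign of the bound `M` is never used (outside `tsupport φ`
both sides vanish); `0 ∉ S` is the only geometric hypothesis (the final slice is typed off the origin).
NS regularity is NOT proved here; nothing below touches 23843, (E1⁺), H₂ or any Liouville statement.
-/

set_option linter.dupNamespace false

open MeasureTheory Set Metric Filter Topology
open scoped ENNReal RealInnerProductSpace

namespace Summit.NavierStokesRegularity.NavierStokesRegularity.Cruxes.ScarEnvelopeTypeI.ZoomDictionary.TraceBridge

local notation "E3" => EuclideanSpace ℝ (Fin 3)

/-! ## 0. Verbatim copies of the two vocabularies -/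

/-- VERBATIM `TerminalLayer.HasFinalSlice`: `u₀` is the final slice of `U` off the origin,
`U(t,x) → u₀(x)` as `t → 0⁻` for every `x ≠ 0`. -/
def HasFinalSlice (U : ℝ → E3 → E3) (u₀ : E3 → E3) : Prop :=
  ∀ x : E3, x ≠ 0 → Tendsto (fun t : ℝ => U t x) (𝓝[<] (0 : ℝ)) (𝓝 (u₀ x))

/-- VERBATIM `FinalTrace.finalTime`: left-neighbourhoods of the final time modulo null sets of times. -/
noncomputable def finalTime : Filter ℝ := (𝓝[<] (0 : ℝ)) ⊓ ae (volume : Measure ℝ)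

/-- VERBATIM `FinalTrace.slicePairing`. -/
noncomputable def slicePairing (U : ℝ → E3 → E3) (φ : E3 → E3) (s : ℝ) : ℝ := ∫ x, ⟪U s x, φ x⟫

/-- VERBATIM `FinalTrace.IsTestOn`. -/
def IsTestOn (S : Set E3) (φ : E3 → E3) : Prop :=
  Continuous φ ∧ HasCompactSupport φ ∧ tsupport φ ⊆ S

/-- VERBATIM `FinalTrace.HasZeroTraceOn`. -/
def HasZeroTraceOn (U : ℝ → E3 → E3) (S : Set E3) : Prop :=
  ∀ φ : E3 → E3, IsTestOn S φ → Tendsto (slicePairing U φ) finalTime (𝓝 0)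

/-- VERBATIM `FinalTrace.TraceEssBddOn`. -/
def TraceEssBddOn (U : ℝ → E3 → E3) (S : Set E3) (A : ℝ) : Prop :=
  ∀ φ : E3 → E3, IsTestOn S φ → ∀ ε : ℝ, 0 < ε →
    ∀ᶠ s in finalTime, |slicePairing U φ s| ≤ A * (∫ x, ‖φ x‖) + ε

/-! ## 1. The essential final-time filter is proper -/

/-- `finalTime` is a proper filter: a left-neighbourhood of `0` contains an interval of positive
length, which cannot be Lebesgue-null.  Hence limits along `finalTime` are unique. -/
theorem finalTime_neBot : finalTime.NeBot := by
  rw [finalTime, Filter.inf_neBot_iff]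
  intro s hs s' hs'
  obtain ⟨l, hl, hls⟩ := mem_nhdsLT_iff_exists_Ioo_subset.1 hs
  by_contra h
  rw [Set.not_nonempty_iff_eq_empty] at h
  have hsub : Ioo l 0 ⊆ s'ᶜ := by
    intro x hx hx'
    have hmem : x ∈ s ∩ s' := ⟨hls hx, hx'⟩
    rw [h] at hmem
    exact hmem
  have h0 : volume (s'ᶜ : Set ℝ) = 0 := mem_ae_iff.1 hs'
  have hnull : volume (Ioo l 0) = 0 := measure_mono_null hsub h0
  rw [Real.volume_Ioo, ENNReal.ofReal_eq_zero] at hnull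
  have hl' : l < 0 := hl
  linarith

/-! ## 2. Slice side ⇒ trace side -/

section Bridge

variable {U : ℝ → E3 → E3} {u₀ : E3 → E3} {S : Set E3} {M δ : ℝ} {φ : E3 → E3}

/-- Outside the topological support a test field vanishes. -/
private theorem test_eq_zero_of_not_mem {x : E3} (hx : x ∉ tsupport φ) : φ x = 0 := by
  by_contra hne
  exact hx (subset_tsupport φ (Function.mem_support.2 hne))

/-- **Pairings converge (along `𝓝[<] 0`).**  A pointwise final slice off the origin and a sup bound
`‖U(s,x)‖ ≤ M` for `s ∈ (−δ, 0)`, `x ∈ S` (with `0 ∉ S`, slices measurable) give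
`∫ ⟪U(s), φ⟫ → ∫ ⟪u₀, φ⟫` as `s → 0⁻` for every test field `φ` on `S` — dominated convergence with
the majorant `M‖φ‖`. -/
theorem tendsto_slicePairing_of_hasFinalSlice (hU : HasFinalSlice U u₀) (h0 : (0 : E3) ∉ S)
    (hmeas : ∀ s : ℝ, AEStronglyMeasurable (U s) volume) (hδ : 0 < δ)
    (hbd : ∀ s ∈ Ioo (-δ) 0, ∀ x ∈ S, ‖U s x‖ ≤ M) (hφ : IsTestOn S φ) :
    Tendsto (slicePairing U φ) (𝓝[<] (0 : ℝ)) (𝓝 (∫ x, ⟪u₀ x, φ x⟫)) := by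
  have hI : Ioo (-δ) 0 ∈ 𝓝[<] (0 : ℝ) := Ioo_mem_nhdsLT (by linarith)
  refine tendsto_integral_filter_of_dominated_convergence (fun x => M * ‖φ x‖) ?_ ?_ ?_ ?_
  · exact Eventually.of_forall fun s => (hmeas s).inner hφ.1.aestronglyMeasurable
  · filter_upwards [hI] with s hs
    refine Eventually.of_forall fun x => ?_
    by_cases hx : x ∈ tsupport φ
    · have hxS : x ∈ S := hφ.2.2 hx
      calc ‖⟪U s x, φ x⟫‖ ≤ ‖U s x‖ * ‖φ x‖ := norm_inner_le_norm _ _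
        _ ≤ M * ‖φ x‖ := mul_le_mul_of_nonneg_right (hbd s hs x hxS) (norm_nonneg _)
    · simp [test_eq_zero_of_not_mem hx]
  · exact ((hφ.1.integrable_of_hasCompactSupport hφ.2.1).norm).const_mul M
  · refine Eventually.of_forall fun x => ?_
    by_cases hx : x ∈ tsupport φ
    · have hx0 : x ≠ 0 := fun h => h0 (h ▸ hφ.2.2 hx)
      exact (hU x hx0).inner tendsto_const_nhds
    · simp [test_eq_zero_of_not_mem hx]

/-- The same convergence along the essential final-time filter `finalTime ≤ 𝓝[<] 0`. -/
theorem tendsto_slicePairing_finalTime_of_hasFinalSlice (hU : HasFinalSlice U u₀) (h0 : (0 : E3) ∉ S)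
    (hmeas : ∀ s : ℝ, AEStronglyMeasurable (U s) volume) (hδ : 0 < δ)
    (hbd : ∀ s ∈ Ioo (-δ) 0, ∀ x ∈ S, ‖U s x‖ ≤ M) (hφ : IsTestOn S φ) :
    Tendsto (slicePairing U φ) finalTime (𝓝 (∫ x, ⟪u₀ x, φ x⟫)) :=
  (tendsto_slicePairing_of_hasFinalSlice hU h0 hmeas hδ hbd hφ).mono_left inf_le_left

/-- The final slice inherits the local bound: `‖u₀ x‖ ≤ M` on `S`. -/
theorem norm_finalSlice_le (hU : HasFinalSlice U u₀) (h0 : (0 : E3) ∉ S) (hδ : 0 < δ)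
    (hbd : ∀ s ∈ Ioo (-δ) 0, ∀ x ∈ S, ‖U s x‖ ≤ M) {x : E3} (hx : x ∈ S) : ‖u₀ x‖ ≤ M := by
  have hx0 : x ≠ 0 := fun h => h0 (h ▸ hx)
  have hI : Ioo (-δ) 0 ∈ 𝓝[<] (0 : ℝ) := Ioo_mem_nhdsLT (by linarith)
  refine le_of_tendsto (hU x hx0).norm ?_
  filter_upwards [hI] with s hs
  exact hbd s hs x hx

/-- The limit pairing is bounded by `M‖φ‖_{L¹}`. -/
theorem abs_finalSlicePairing_le (hU : HasFinalSlice U u₀) (h0 : (0 : E3) ∉ S) (hδ : 0 < δ)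
    (hbd : ∀ s ∈ Ioo (-δ) 0, ∀ x ∈ S, ‖U s x‖ ≤ M) (hφ : IsTestOn S φ) :
    |∫ x, ⟪u₀ x, φ x⟫| ≤ M * ∫ x, ‖φ x‖ := by
  have hbound : ∀ᵐ x ∂(volume : Measure E3), ‖⟪u₀ x, φ x⟫‖ ≤ M * ‖φ x‖ := by
    refine Eventually.of_forall fun x => ?_
    by_cases hx : x ∈ tsupport φ
    · have hxS : x ∈ S := hφ.2.2 hx
      calc ‖⟪u₀ x, φ x⟫‖ ≤ ‖u₀ x‖ * ‖φ x‖ := norm_inner_le_norm _ _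
        _ ≤ M * ‖φ x‖ :=
          mul_le_mul_of_nonneg_right (norm_finalSlice_le hU h0 hδ hbd hxS) (norm_nonneg _)
    · simp [test_eq_zero_of_not_mem hx]
  have hint : Integrable (fun x => M * ‖φ x‖) (volume : Measure E3) :=
    ((hφ.1.integrable_of_hasCompactSupport hφ.2.1).norm).const_mul M
  have hle := norm_integral_le_of_norm_le hint hbound
  rw [integral_const_mul] at hle
  calc |∫ x, ⟪u₀ x, φ x⟫| = ‖∫ x, ⟪u₀ x, φ x⟫‖ := (Real.norm_eq_abs _).symm
    _ ≤ M * ∫ x, ‖φ x‖ := hle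

/-- **THE NAMED BRIDGE (V10-P2 / V11-P3): slice side ⇒ trace side on the regular set.**  If `U` has
a pointwise final slice off the origin and is bounded by `M` on `(−δ,0) × S` (`0 ∉ S`; e.g. `S` a
ball of final-time regular points, or any set at positive distance from the scar under the Type-I
envelope `‖U‖ ≤ A/‖x‖`), then the distributional final trace of `U` is essentially bounded by `M`
on `S` in the sense of `FinalTrace.TraceEssBddOn`. -/
theorem traceEssBddOn_of_hasFinalSlice_bdd (hU : HasFinalSlice U u₀) (h0 : (0 : E3) ∉ S)
    (hmeas : ∀ s : ℝ, AEStronglyMeasurable (U s) volume) (hδ : 0 < δ)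
    (hbd : ∀ s ∈ Ioo (-δ) 0, ∀ x ∈ S, ‖U s x‖ ≤ M) : TraceEssBddOn U S M := by
  intro φ hφ ε hε
  have hlim := tendsto_slicePairing_finalTime_of_hasFinalSlice hU h0 hmeas hδ hbd hφ
  have hL := abs_finalSlicePairing_le hU h0 hδ hbd hφ
  have hev : ∀ᶠ s in finalTime, dist (slicePairing U φ s) (∫ x, ⟪u₀ x, φ x⟫) < ε :=
    (Metric.tendsto_nhds.1 hlim) ε hε
  filter_upwards [hev] with s hs
  rw [Real.dist_eq] at hs
  have h1 := abs_sub_abs_le_abs_sub (slicePairing U φ s) (∫ x, ⟪u₀ x, φ x⟫)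
  linarith

/-! ## 3. Slice = trace where both exist (pairing level) -/

/-- **Uniqueness.**  Under the same hypotheses, if the pairing with a test field `φ` on `S` has ANY
essential final limit `c` (a «distributional final trace» value), then `c = ∫ ⟪u₀, φ⟫`: the
distributional trace and the pointwise final slice agree on every test field on `S`. -/
theorem tracePairing_eq_of_hasFinalSlice (hU : HasFinalSlice U u₀) (h0 : (0 : E3) ∉ S)
    (hmeas : ∀ s : ℝ, AEStronglyMeasurable (U s) volume) (hδ : 0 < δ)
    (hbd : ∀ s ∈ Ioo (-δ) 0, ∀ x ∈ S, ‖U s x‖ ≤ M) (hφ : IsTestOn S φ) {c : ℝ}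
    (hc : Tendsto (slicePairing U φ) finalTime (𝓝 c)) : c = ∫ x, ⟪u₀ x, φ x⟫ :=
  haveI := finalTime_neBot
  tendsto_nhds_unique hc (tendsto_slicePairing_finalTime_of_hasFinalSlice hU h0 hmeas hδ hbd hφ)

/-- **Zero trace ⟺ orthogonal final slice.**  Under the same hypotheses, `U` has zero final trace
on `S` iff its final slice is orthogonal to every test field on `S` (equivalently, by the
fundamental lemma of the calculus of variations applied componentwise, `u₀ = 0` a.e. on `S` when
`S` is open). -/
theorem hasZeroTraceOn_iff_finalSlice_orthogonal (hU : HasFinalSlice U u₀) (h0 : (0 : E3) ∉ S)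
    (hmeas : ∀ s : ℝ, AEStronglyMeasurable (U s) volume) (hδ : 0 < δ)
    (hbd : ∀ s ∈ Ioo (-δ) 0, ∀ x ∈ S, ‖U s x‖ ≤ M) :
    HasZeroTraceOn U S ↔ ∀ φ : E3 → E3, IsTestOn S φ → ∫ x, ⟪u₀ x, φ x⟫ = 0 := by
  constructor
  · intro h φ hφ
    exact (tracePairing_eq_of_hasFinalSlice hU h0 hmeas hδ hbd hφ (h φ hφ)).symm
  · intro h φ hφ
    have := tendsto_slicePairing_finalTime_of_hasFinalSlice hU h0 hmeas hδ hbd hφ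
    rwa [h φ hφ] at this

/-- Scalar bump times a fixed vector is a test field on `S`. -/
private theorem isTestOn_smul_const {g : E3 → ℝ} (hg : Continuous g) (hgc : HasCompactSupport g)
    (hgS : tsupport g ⊆ S) (e : E3) : IsTestOn S (fun x => g x • e) :=
  ⟨hg.smul continuous_const, hgc.mono (Function.support_smul_subset_left g fun _ => e),
    (tsupport_smul_subset_left g fun _ => e).trans hgS⟩

/-- **Slice = trace a.e. where both exist (the fundamental-lemma upgrade).**  If, on an open set
`S ∌ 0` where `U` is locally bounded near the final time, the pairings have a distributional final
trace represented by a locally integrable field `v` (`∫⟪U(s), φ⟫ → ∫⟪v, φ⟫` essentially as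
`s → 0⁻` for every test field on `S`), then `v = u₀` a.e. on `S`.  (Local integrability of `u₀`
holds in the A–B class from the envelope `‖u₀‖ ≤ A/‖x‖`; it is an explicit hypothesis here.) -/
theorem finalSlice_ae_eq_trace (hS : IsOpen S) (hU : HasFinalSlice U u₀) (h0 : (0 : E3) ∉ S)
    (hmeas : ∀ s : ℝ, AEStronglyMeasurable (U s) volume) (hδ : 0 < δ)
    (hbd : ∀ s ∈ Ioo (-δ) 0, ∀ x ∈ S, ‖U s x‖ ≤ M) (hu₀ : LocallyIntegrable u₀ volume)
    {v : E3 → E3} (hv : LocallyIntegrable v volume)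
    (htr : ∀ φ : E3 → E3, IsTestOn S φ →
      Tendsto (slicePairing U φ) finalTime (𝓝 (∫ x, ⟪v x, φ x⟫))) :
    ∀ᵐ x ∂(volume : Measure E3), x ∈ S → v x = u₀ x := by
  -- every test pairing of `v` equals that of `u₀`
  have hpair : ∀ φ : E3 → E3, IsTestOn S φ → ∫ x, ⟪v x, φ x⟫ = ∫ x, ⟪u₀ x, φ x⟫ := fun φ hφ =>
    tracePairing_eq_of_hasFinalSlice hU h0 hmeas hδ hbd hφ (htr φ hφ)
  -- hence every scalar-bump moment of `v - u₀` vanishes, vector by vector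
  have hmom : ∀ g : E3 → ℝ, ContDiff ℝ (⊤ : ℕ∞) g → HasCompactSupport g → tsupport g ⊆ S →
      ∫ x, g x • (v - u₀) x = 0 := by
    intro g hg hgc hgS
    have hgv : Integrable (fun x => g x • v x) :=
      hv.integrable_smul_left_of_hasCompactSupport hg.continuous hgc
    have hgu : Integrable (fun x => g x • u₀ x) :=
      hu₀.integrable_smul_left_of_hasCompactSupport hg.continuous hgc
    have hvec : ∫ x, g x • v x = ∫ x, g x • u₀ x := by
      refine ext_inner_left ℝ fun e => ?_
      have h1 := hpair (fun x => g x • e) (isTestOn_smul_const hg.continuous hgc hgS e)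
      have hl : ∫ x, ⟪v x, g x • e⟫ = ⟪e, ∫ x, g x • v x⟫ := by
        rw [← integral_inner hgv e]
        refine integral_congr_ae (Eventually.of_forall fun x => ?_)
        simp only [real_inner_smul_right, real_inner_comm]
      have hr : ∫ x, ⟪u₀ x, g x • e⟫ = ⟪e, ∫ x, g x • u₀ x⟫ := by
        rw [← integral_inner hgu e]
        refine integral_congr_ae (Eventually.of_forall fun x => ?_)
        simp only [real_inner_smul_right, real_inner_comm]
      rw [← hl, ← hr, h1]
    have : (fun x => g x • (v - u₀) x) = fun x => g x • v x - g x • u₀ x := by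
      funext x; rw [Pi.sub_apply, smul_sub]
    rw [this, integral_sub hgv hgu, hvec, sub_self]
  have hz := hS.ae_eq_zero_of_integral_contDiff_smul_eq_zero
    ((hv.sub hu₀).locallyIntegrableOn S) hmom
  filter_upwards [hz] with x hx hxS
  exact sub_eq_zero.1 (by simpa [Pi.sub_apply] using hx hxS)

/-- In particular: zero final trace on such an `S` forces the final slice to vanish a.e. on `S`. -/
theorem finalSlice_ae_eq_zero_of_hasZeroTraceOn (hS : IsOpen S) (hU : HasFinalSlice U u₀)
    (h0 : (0 : E3) ∉ S) (hmeas : ∀ s : ℝ, AEStronglyMeasurable (U s) volume) (hδ : 0 < δ)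
    (hbd : ∀ s ∈ Ioo (-δ) 0, ∀ x ∈ S, ‖U s x‖ ≤ M) (hu₀ : LocallyIntegrable u₀ volume)
    (hZ : HasZeroTraceOn U S) : ∀ᵐ x ∂(volume : Measure E3), x ∈ S → u₀ x = 0 := by
  have h := finalSlice_ae_eq_trace hS hU h0 hmeas hδ hbd hu₀ (v := fun _ => (0 : E3))
    (locallyIntegrable_const (0 : E3)) (fun φ hφ => by simpa using hZ φ hφ)
  filter_upwards [h] with x hx hxS
  exact (hx hxS).symm

end Bridge

/-! ## 4. Designed checks (the hypotheses are not vacuous; the bound's sign is never used) -/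

/-- A static field is its own final slice. -/
example (v : E3 → E3) : HasFinalSlice (fun _ => v) v := fun _ _ => tendsto_const_nhds

/-- The zero field has zero trace everywhere (no hypotheses needed). -/
example (S : Set E3) : HasZeroTraceOn (fun _ _ => (0 : E3)) S := by
  intro φ _
  have h : slicePairing (fun _ _ => (0 : E3)) φ = fun _ => 0 := by
    funext s
    simp [slicePairing]
  rw [h]
  exact tendsto_const_nhds

end Summit.NavierStokesRegularity.NavierStokesRegularity.Cruxes.ScarEnvelopeTypeI.ZoomDictionary.TraceBridge
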